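import Literature.MathematicalPhysics.QuantumLattice.HeatKernelGroupGaugeProofs
import Literature.MathematicalPhysics.QuantumLattice.LatticeGaugeDLRProofs
import HarnessLib

/-!
# Gauge invariance of the heat-kernel lattice gauge measure: discharge of
`groupHeatKernelMeasure_map_gaugeTransform`

Sibling proof file of `Literature/MathematicalPhysics/QuantumLattice/HeatKernelGroup.lean` (next to
`HeatKernelGroupProofs.lean` (`comp_mul`), `HeatKernelGroupGaugeProofs.lean`
(`groupHeatKernelWeight_gaugeTransform`), `HeatKernelGroupCircleProofs.lean`
(`circleHeatKernel_eq_jacobiTheta₂`) and `HeatKernelGroupMeasureProofs.lean`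
(`isProbabilityMeasure_groupHeatKernelMeasure`)), same namespace
`Literature.MathematicalPhysics.QuantumLattice`: it discharges the named fact
`Literature.MathematicalPhysics.QuantumLattice.groupHeatKernelMeasure_map_gaugeTransform` (D-0014)
as `theorem groupHeatKernelMeasure_map_gaugeTransform_holds : groupHeatKernelMeasure_map_gaugeTransform`,
i.e. for a heat kernel `p` of the compact group `G` (`IsGroupHeatKernel p`), every `t > 0` and
every gauge transformation `g : Λ → G` of the torus `Λ = (ℤ/L)^d`, the push-forward of the
heat-kernel lattice gauge measure `μ_t(dU) = Z⁻¹ ∏_q p_t(U_q) ∏_e dHaar(U_e)`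
(`groupHeatKernelMeasure p t`) under `U ↦ U^g` (`gaugeTransform g`) is `μ_t` itself.
No definition or statement is introduced or changed; the file declares this one theorem.

## Sources

* B. K. Driver, *YM₂: continuum expectations, lattice convergence, and lassos*, Comm. Math.
  Phys. **123** (1989) 575–616, §7 ((7.1)–(7.4), pp. 597–598; Thm 7.5, p. 600) and §8 (Def. 8.3, p. 601)
  [cite: Driver1989]: the heat-kernel lattice action
  `∏_{plaquettes} p_t(U_q)` in place of the Wilson action and the corresponding normalised
  lattice measure; its gauge invariance is the remark that the product Haar measure and the
  central density are both invariant under `U ↦ U^g`. (The paper is held by the literature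
  store, key `paper:url-6645d44e7164` = the Project Euclid open copy euclid.cmp/1104178984; the
  argument below is the standard one, identical to the gauge invariance of the Wilson lattice measure, and uses
  only the vendored definitions.)
* E. Seiler, *Gauge Theories as a Problem of Constructive Quantum Field Theory and Statistical
  Mechanics*, LNP 159 (1982), Ch. 1–2: lattice gauge measures built from a gauge-invariant action
  and the bi-invariant Haar measure of the compact structure group are gauge invariant.

## Proof

Write `T = gaugeTransform g`, `π = Haar^{⊗E}` (Mathlib `Measure.pi` of the normalised Haar
measures `haarProbability G` over the positively oriented edges `E` of the torus) and
`ρ = ENNReal.ofReal ∘ w_t`, `w_t(U) = ∏_q p_t(U_q)` (`groupHeatKernelWeight p t`), so that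
`μ_t = ((π.withDensity ρ) univ)⁻¹ • π.withDensity ρ` (`groupHeatKernelMeasure`).
1. Every gauge transformation preserves `π`: edge by edge `U(x,i) ↦ γ(x) U(x,i) γ(x+eᵢ)⁻¹` is a
   two-sided translation, which preserves the Haar probability measure of the compact
   (unimodular) group `G` (`measurePreserving_mul_mul_inv_haarProbability`, file
   `LatticeGaugeDLRProofs`: conjugation is a continuous surjective endomorphism, hence
   Haar-measure preserving by uniqueness, and left translations preserve Haar measure), and
   `Measure.pi` is preserved factorwise (Mathlib `measurePreserving_pi`).
2. `T` is a measurable bijection with measurable inverse `gaugeTransform g⁻¹`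
   (`(U^g)^{g⁻¹} = U`), i.e. a measurable equivalence `e`.
3. `ρ ∘ T = ρ`: the weight is gauge invariant (`groupHeatKernelWeight_gaugeTransform_holds`, file
   `HeatKernelGroupGaugeProofs`: plaquette holonomies are conjugated and `p_t` is central).
4. For a measurable equivalence `e` with `π.map e = π` and `ρ ∘ e = ρ`,
   `(π.withDensity ρ).map e = π.withDensity ρ`: on a measurable set `s` both sides equal
   `∫⁻_{e⁻¹ s} ρ dπ` (Mathlib `Measure.restrict_map`, `lintegral_map_equiv`). No measurability
   of `ρ` is used, so no second countability of `G` has to be assumed.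
5. `Measure.map` commutes with the normalising scalar `Z⁻¹ = ((π.withDensity ρ) univ)⁻¹`
   (Mathlib `Measure.map_smul`), and `Z` itself is untouched.

Not here: that `μ_t` is a probability measure (`isProbabilityMeasure_groupHeatKernelMeasure_holds`,
file `HeatKernelGroupMeasureProofs.lean`); the invariance below holds for the junk values too.
-/

noncomputable section

open MeasureTheory
open scoped ENNReal
open Literature.MathematicalPhysics.QuantumFieldTheory

namespace Literature.MathematicalPhysics.QuantumLattice

variable {G : Type*} [Group G] [TopologicalSpace G] [IsTopologicalGroup G] [CompactSpace G]
  [MeasurableSpace G] [BorelSpace G] {d L : ℕ}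

/-- **Gauge invariance of the heat-kernel lattice gauge measure** — discharge of
`groupHeatKernelMeasure_map_gaugeTransform` (Driver, CMP 123 (1989) §7). For a heat kernel `p`
of the compact group `G`, `t > 0` and `g : Λ → G`, the push-forward of
`μ_t = Z⁻¹ ∏_q p_t(U_q) ∏_e dHaar(U_e)` under `U ↦ U^g` is `μ_t`: `U ↦ U^g` is a measurable
bijection (inverse `U ↦ U^{g⁻¹}`) preserving the product Haar measure (edgewise two-sided
translations of the normalised Haar measure of a compact group, Mathlib `measurePreserving_pi`
with `measurePreserving_mul_mul_inv_haarProbability`) and the density `∏_q p_t(U_q)`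
(`groupHeatKernelWeight_gaugeTransform_holds`: holonomies are conjugated, `p_t` is central), hence
the un-normalised measure (change of variables along a measurable equivalence, Mathlib
`lintegral_map_equiv` — no measurability of the density is needed), and the normalisation `Z⁻¹`
commutes with the push-forward (`Measure.map_smul`). [cite: Driver1989, §7 ((7.1); Thm 7.5 p. 600)] -/
theorem groupHeatKernelMeasure_map_gaugeTransform_holds :
    groupHeatKernelMeasure_map_gaugeTransform (G := G) (d := d) (L := L) := by
  intro _ p hp t ht g
  -- (1) gauge transformations preserve the product Haar measure `Haar^{⊗E}`
  have hmp : ∀ γ : Site d L → G,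
      MeasurePreserving (gaugeTransform γ : GaugeConfig d L G → GaugeConfig d L G)
        (Measure.pi fun _ : Edge d L => haarProbability G)
        (Measure.pi fun _ : Edge d L => haarProbability G) := fun γ =>
    measurePreserving_pi (f := fun (e : Edge d L) (x : G) => γ e.1 * x * (γ (e.1.shift e.2))⁻¹)
      (fun _ : Edge d L => haarProbability G) (fun _ : Edge d L => haarProbability G)
      fun e => measurePreserving_mul_mul_inv_haarProbability (γ e.1) (γ (e.1.shift e.2))
  -- (2) the gauge transformation by `g` as a measurable equivalence, inverse: by `g⁻¹`
  let e : GaugeConfig d L G ≃ᵐ GaugeConfig d L G :=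
    { toFun := gaugeTransform g
      invFun := gaugeTransform g⁻¹
      left_inv := fun U => by
        funext x
        simp [gaugeTransform, mul_assoc]
      right_inv := fun U => by
        funext x
        simp [gaugeTransform, mul_assoc]
      measurable_toFun := (hmp g).measurable
      measurable_invFun := (hmp g⁻¹).measurable }
  have he : (⇑e : GaugeConfig d L G → GaugeConfig d L G) = gaugeTransform g := rfl
  have hπ : (Measure.pi fun _ : Edge d L => haarProbability G).map e =
      Measure.pi fun _ : Edge d L => haarProbability G := by
    rw [he]
    exact (hmp g).map_eq
  -- (3) the density is gauge invariant
  have hρ : ∀ U : GaugeConfig d L G,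
      (fun V : GaugeConfig d L G => ENNReal.ofReal (groupHeatKernelWeight p t V)) (e U) =
        (fun V : GaugeConfig d L G => ENNReal.ofReal (groupHeatKernelWeight p t V)) U := by
    intro U
    show ENNReal.ofReal (groupHeatKernelWeight p t (gaugeTransform g U)) =
      ENNReal.ofReal (groupHeatKernelWeight p t U)
    rw [groupHeatKernelWeight_gaugeTransform_holds (d := d) (L := L) hp ht g U]
  -- (4) `withDensity` is preserved by a measurable equivalence preserving measure and density
  have key : ∀ (μ : Measure (GaugeConfig d L G)) (ρ : GaugeConfig d L G → ℝ≥0∞),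
      μ.map e = μ → (∀ U, ρ (e U) = ρ U) → (μ.withDensity ρ).map e = μ.withDensity ρ := by
    intro μ ρ hμ hρ'
    ext s hs
    rw [Measure.map_apply e.measurable hs, withDensity_apply _ (e.measurable hs),
      withDensity_apply _ hs]
    conv_rhs => rw [← hμ]
    rw [Measure.restrict_map e.measurable hs, lintegral_map_equiv]
    simp only [hρ']
  have h := key (Measure.pi fun _ : Edge d L => haarProbability G)
    (fun V : GaugeConfig d L G => ENNReal.ofReal (groupHeatKernelWeight p t V)) hπ hρ
  rw [he] at h
  -- (5) the normalising scalar commutes with the push-forward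
  simp only [groupHeatKernelMeasure, Measure.map_smul, h]

end Literature.MathematicalPhysics.QuantumLattice
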